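import Summits.HodgeConjecture.HodgeConjecture.Theorems.Q8SymplecticPowersQuaternionicCasimirBlocks
import Summits.HodgeConjecture.HodgeConjecture.Theorems.Q8SymplecticPowersDoubledAlphabetFFT
import Summits.HodgeConjecture.HodgeConjecture.Theorems.Q8SymplecticPowersCentraliserInvariance
import HarnessLib

/-!
# Route `Q8SymplecticPowers`, programme K2Q ∕ F-Q — brick F1C (part c): **the quaternionic tensor FFT** — a coefficient
# tensor fixed by the quaternionic-unitary centraliser (or only by its Cayley commutators) is a combination of matching
# tensors whose pairs carry the quaternionic Casimir matrices `[d]_β [Q]_β⁻¹`, `d ∈ {1, a, b, ab}`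

Support file for crux K2Q `PowersHodgeOfQuaternionCommutators` (stmt-HodgeConjecture-24191; `--supports … --as helper`;
nothing here closes an item). Prover seat `hodge-nonav-20241-p1` (g21). Pure invariant theory over a field `K` of
characteristic `0` with `i² = −1`; `V` finite-dimensional, `Q` symmetric non-degenerate, `a, b` `Q`-isometries with
`a² = b² = −1`, `ab = −ba` (the rung `Q8CommutatorDegreeTwoCore*`); `Z` = the quaternionic-unitary centraliser.

This is the all-degrees first fundamental theorem behind `stub_higherPowersQ` (the degree-2 case is the ENGINE
`q8Commutator_invariant_bilinForm_eq`, p705032): `V ⊗ K = M ⊗ K²` with `Z ≅ Sp(M)` acting on the first factor, so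
`(V^{⊗m})^Z = (M^{⊗m})^{Sp(M)} ⊗ (K²)^{⊗m}` = perfect matchings with `End(K²) = D ⊗ K = ⟨1, a, b, ab⟩`-decorated pairings
(Goodman–Wallach Thm. 5.3.3 (2) ∕ Prop. 4.2.5). Assembly of the bricks F1A (adapted basis, `Z ⊇` diagonal `Sp(Ω)`), F1C-a
(`Q8SymplecticPowersDoubledAlphabetFFT`: diagonal-`Sp` FFT on the doubled alphabet), F1C-b (`…QuaternionicCasimirBlocks`:
block placements = combinations of Casimir matrices) and F1B (`…CentraliserInvariance`: Cayley commutators ⇒ all of `Z`):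

* §1 Kronecker powers of rectangular matrices (`of_prod_mul`, `of_prod_one`), multilinear expansion of tagged
  contractions in their tags (`taggedContraction_eq_sum_of_eq_sum_smul`), base change of Casimir matrices over `K`
  (`casimir_basis_change`);
* §2 `mem_span_taggedContraction_adapted` — the theorem in an adapted basis;
* §3 **`mem_span_taggedContraction_of_centraliser_invariant`** — in ANY basis `bV : Fin n` of `V`: a coefficient tensor
  `c : (Fin m → Fin n) → K` with `[z]_{bV}^{⊗m} c = c` for all `z ∈ Z` lies in the `K`-span of the tagged contractions
  `taggedContraction (d ↦ [d]_{bV} [Q]_{bV}⁻¹) e δ` (`e` a perfect matching of `Fin m`, `δ : pairs → Fin 4` indexing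
  `(1, a, b, ab)`); **`…_of_cayley_commutators`** — the same assuming invariance only under the Cayley commutators of `Z`.

HONEST FRAMING: invariant theory only (axioms standard); item 24191 OPEN; nothing here says HC ∕ HC_CM ∕ HC_AV is proved.

## References

* R. Goodman, N. Wallach, *Symmetry, Representations, and Invariants*, GTM 255 (2009), §5.3.2 Thm. 5.3.3 (2), Thm. 5.3.5,
  §4.2.2 Prop. 4.2.5, §11.3.5. [cite: GoodmanWallachGTM255]
* P. Deligne, *La conjecture de Weil II*, Publ. Math. IHÉS 52 (1980), §4.4. [cite: Deligne1980]
-/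

set_option linter.dupNamespace false

noncomputable section

open Module
open scoped BigOperators Matrix

namespace Summit.HodgeConjecture.HodgeConjecture.Theorems.Q8SymplecticPowersQuaternionicTensorFFT

open Literature.RepresentationTheory.ClassicalInvariants (taggedContraction taggedContraction_apply
  sum_prod_mul_taggedContraction)
open Literature.NumberTheory.DiophantineGeometry (tensorPowerMatrix tensorPowerMatrix_apply)
open Summit.HodgeConjecture.HodgeConjecture.Theorems.Q8SymplecticPowersQuaternionicAdaptedBasis
open Summit.HodgeConjecture.HodgeConjecture.Theorems.Q8SymplecticPowersQuaternionicCasimirBlocks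
open Summit.HodgeConjecture.HodgeConjecture.Theorems.Q8SymplecticPowersDoubledAlphabetFFT
open Summit.HodgeConjecture.HodgeConjecture.Theorems.Q8SymplecticPowersCentraliserInvariance

universe u v

variable {K : Type u} [Field K]

/-! ### §1 Kronecker powers of rectangular matrices; expansion of tagged contractions; Casimir base change -/

/-- **Kronecker powers are multiplicative** (rectangular matrices). [cite: GoodmanWallachGTM255, §5.3.2] -/
theorem of_prod_mul {A B C : Type*} [Fintype A] [Fintype B] [Fintype C] (M : Matrix A B K) (N : Matrix B C K) (m : ℕ) :
    (Matrix.of fun (w' : Fin m → A) (w : Fin m → C) => ∏ t, (M * N) (w' t) (w t)) =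
      (Matrix.of fun (w' : Fin m → A) (v : Fin m → B) => ∏ t, M (w' t) (v t)) *
        (Matrix.of fun (v : Fin m → B) (w : Fin m → C) => ∏ t, N (v t) (w t)) := by
  ext w' w
  simp only [Matrix.of_apply, Matrix.mul_apply]
  rw [Fintype.prod_sum]
  refine Finset.sum_congr rfl fun v _ => ?_
  rw [Finset.prod_mul_distrib]

/-- The Kronecker power of `1` is `1`. [cite: GoodmanWallachGTM255, §5.3.2] -/
theorem of_prod_one {A : Type*} [Fintype A] [DecidableEq A] (m : ℕ) :
    (Matrix.of fun (w' w : Fin m → A) => ∏ t, (1 : Matrix A A K) (w' t) (w t)) = 1 := by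
  ext w' w
  rw [Matrix.of_apply, Matrix.one_apply]
  by_cases h : w' = w
  · subst h; simp
  · obtain ⟨p, hp⟩ := Function.ne_iff.1 h
    rw [if_neg h]
    exact Finset.prod_eq_zero (Finset.mem_univ p) (Matrix.one_apply_ne hp)

/-- **Multilinear expansion of a tagged contraction in its tags**: if every tag matrix `Θ c` is a combination
`Σ_d λ c d • Θ' d`, then `taggedContraction Θ e τ = Σ_δ (∏ⱼ λ (τ j) (δ j)) • taggedContraction Θ' e δ`.
[cite: GoodmanWallachGTM255, §5.3.2] -/
theorem taggedContraction_eq_sum_of_eq_sum_smul {A ι ι' : Type*} [Fintype ι'] [DecidableEq ι'] {P : Type*} [Fintype P]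
    (Θ : ι → Matrix A A K) (Θ' : ι' → Matrix A A K) (lam : ι → ι' → K) (h : ∀ c, Θ c = ∑ d, lam c d • Θ' d)
    {J : Type*} [Fintype J] [DecidableEq J] (e : P ≃ Fin 2 × J) (τ : J → ι) :
    taggedContraction Θ e τ = ∑ δ : J → ι', (∏ j, lam (τ j) (δ j)) • taggedContraction Θ' e δ := by
  funext w
  rw [taggedContraction_apply, Finset.sum_apply]
  have hfac : ∀ j, Θ (τ j) (w (e.symm (0, j))) (w (e.symm (1, j))) =
      ∑ d, lam (τ j) d * Θ' d (w (e.symm (0, j))) (w (e.symm (1, j))) := fun j => by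
    rw [h (τ j), Matrix.sum_apply]
    exact Finset.sum_congr rfl fun d _ => by rw [Matrix.smul_apply, smul_eq_mul]
  simp_rw [hfac]
  rw [Fintype.prod_sum]
  refine Finset.sum_congr rfl fun δ _ => ?_
  rw [Pi.smul_apply, smul_eq_mul, taggedContraction_apply, Finset.prod_mul_distrib]

/-- **Base change of the Casimir matrices over `K`**: `P ([f]_{b₁} [Q]_{b₁}⁻¹) Pᵀ = [f]_{b₂} [Q]_{b₂}⁻¹` for
`P = b₂.toMatrix b₁` (twin of the tree's `casimirMatrix_basis_change` over `ℚ`). [cite: GoodmanWallachGTM255, §11.3.5] -/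
theorem casimir_basis_change {V : Type v} [AddCommGroup V] [Module K V] {A₁ A₂ : Type*} [Fintype A₁] [DecidableEq A₁]
    [Fintype A₂] [DecidableEq A₂] (b₁ : Basis A₁ K V) (b₂ : Basis A₂ K V) {Q : LinearMap.BilinForm K V}
    (hQn : Q.Nondegenerate) (f : V →ₗ[K] V) :
    b₂.toMatrix b₁ * (LinearMap.toMatrix b₁ b₁ f * (LinearMap.BilinForm.toMatrix b₁ Q)⁻¹) * (b₂.toMatrix b₁)ᵀ =
      LinearMap.toMatrix b₂ b₂ f * (LinearMap.BilinForm.toMatrix b₂ Q)⁻¹ := by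
  set P := b₂.toMatrix b₁ with hPdef
  set P' := b₁.toMatrix b₂ with hP'def
  set G₁ := LinearMap.BilinForm.toMatrix b₁ Q with hG₁def
  set G₂ := LinearMap.BilinForm.toMatrix b₂ Q with hG₂def
  have hPP' : P * P' = 1 := Basis.toMatrix_mul_toMatrix_flip b₂ b₁
  have hP'P : P' * P = 1 := Basis.toMatrix_mul_toMatrix_flip b₁ b₂
  have hf : LinearMap.toMatrix b₂ b₂ f = P * LinearMap.toMatrix b₁ b₁ f * P' :=
    (basis_toMatrix_mul_linearMap_toMatrix_mul_basis_toMatrix b₂ b₁ b₂ b₁ f).symm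
  have hG : G₂ = P'ᵀ * G₁ * P' := (LinearMap.BilinForm.toMatrix_mul_basis_toMatrix b₁ b₂ Q).symm
  have hG₁ : IsUnit G₁.det :=
    isUnit_iff_ne_zero.2 ((LinearMap.BilinForm.nondegenerate_iff_det_ne_zero b₁).1 hQn)
  have hG₂inv : G₂⁻¹ = P * G₁⁻¹ * Pᵀ := by
    apply Matrix.inv_eq_right_inv
    rw [hG]
    simp only [Matrix.mul_assoc]
    rw [← Matrix.mul_assoc P' P, hP'P, Matrix.one_mul, ← Matrix.mul_assoc G₁, Matrix.mul_nonsing_inv _ hG₁,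
      Matrix.one_mul, ← Matrix.transpose_mul, hPP', Matrix.transpose_one]
  rw [hf, hG₂inv]
  simp only [Matrix.mul_assoc]
  rw [← Matrix.mul_assoc P' P, hP'P, Matrix.one_mul]

/-! ### §2 The FFT in an adapted basis -/

section Adapted

variable {V : Type v} [AddCommGroup V] [Module K V] {Q : LinearMap.BilinForm K V} {a b : V →ₗ[K] V} {i : K}
  {k : ℕ} (β : Basis (Fin k ⊕ Fin k) K V) (hM : ∀ p, a (β (Sum.inl p)) = i • β (Sum.inl p))
  (hb : ∀ p, β (Sum.inr p) = b (β (Sum.inl p)))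

include hM hb

/-- **The quaternionic tensor FFT in an adapted basis**: a coefficient tensor on `(Fin k ⊕ Fin k)`-words fixed by
`[z]_β^{⊗m}` for every `z` in the quaternionic-unitary centraliser is a `K`-combination of the tagged contractions with
pair matrices `[d]_β [Q]_β⁻¹`, `d ∈ {1, a, b, ab}`. [cite: GoodmanWallachGTM255, §5.3.2 Thm. 5.3.3 (2) and §4.2.2 Prop. 4.2.5] -/
theorem mem_span_taggedContraction_adapted [CharZero K] (hQs : ∀ x y, Q x y = Q y x) (hQn : Q.Nondegenerate)
    (haa : ∀ x, a (a x) = -x) (hbb : ∀ x, b (b x) = -x) (hab : ∀ x, a (b x) = -b (a x))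
    (haQ : ∀ x y, Q (a x) (a y) = Q x y) (hQb : ∀ x y, Q (b x) (b y) = Q x y) (hi : i * i = -1) {m : ℕ}
    (c : (Fin m → Fin k ⊕ Fin k) → K)
    (hc : ∀ z : V ≃ₗ[K] V, (∀ x, z (a x) = a (z x)) → (∀ x, z (b x) = b (z x)) → (∀ x y, Q (z x) (z y) = Q x y) →
      (Matrix.of fun w' w : Fin m → Fin k ⊕ Fin k => ∏ t, LinearMap.toMatrix β β (z : V →ₗ[K] V) (w' t) (w t)) *ᵥ c = c) :
    c ∈ Submodule.span K {f : (Fin m → Fin k ⊕ Fin k) → K | ∃ (j : ℕ) (e : Fin m ≃ Fin 2 × Fin j) (δ : Fin j → Fin 4),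
      f = taggedContraction (fun d : Fin 4 => LinearMap.toMatrix β β ((![(1 : V →ₗ[K] V), a, b, a * b] : Fin 4 → _) d) *
        (LinearMap.BilinForm.toMatrix β Q)⁻¹) e δ} := by
  classical
  -- invariance under the diagonal `Sp(Ω)`
  have hdiag : ∀ γ : Matrix (Fin k) (Fin k) K,
      γᵀ * (Matrix.of fun p q : Fin k => Q (β (Sum.inl p)) (β (Sum.inr q))) * γ =
        (Matrix.of fun p q : Fin k => Q (β (Sum.inl p)) (β (Sum.inr q))) →
      ∀ w' : Fin m → Fin k ⊕ Fin k, (∑ w, (∏ t, Matrix.fromBlocks γ 0 0 γ (w' t) (w t)) * c w) = c w' := by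
    intro γ hγ w'
    obtain ⟨z, hza, hzb, hzQ, hzm⟩ :=
      exists_centraliser_of_transpose_mul_omega_mul β hM hb hQs hQn haa hbb hab haQ hQb hi γ hγ
    have h := congr_fun (hc z hza hzb hzQ) w'
    rw [hzm] at h
    rw [← h, Matrix.mulVec, dotProduct]
    rfl
  have hspan := mem_span_taggedContraction_blockPlace_of_diagonal_invariant (isAlt_toBilin'_omega β hb hQs hbb hQb)
    (nondegenerate_toBilin'_omega β hM hb hQs hQn haa hbb hab haQ hi) c hdiag
  obtain ⟨lam, hlam⟩ := exists_blockPlace_eq_sum_smul_theta β hM hb hQs hQn haa hbb hab haQ hQb hi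
  refine (Submodule.span_le.2 ?_) hspan
  rintro _ ⟨j, e, τ, rfl⟩
  rw [taggedContraction_eq_sum_of_eq_sum_smul _ _ lam hlam e τ]
  exact Submodule.sum_mem _ fun δ _ => Submodule.smul_mem _ _ (Submodule.subset_span ⟨j, e, δ, rfl⟩)

end Adapted

/-! ### §3 The FFT in an arbitrary basis -/

section AnyBasis

variable {V : Type v} [AddCommGroup V] [Module K V] {Q : LinearMap.BilinForm K V} {a b : V →ₗ[K] V} {i : K}

/-- **The quaternionic tensor FFT.** Let `K` have characteristic `0` and `i² = −1`; `V` finite-dimensional with a symmetric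
non-degenerate `Q` and a quaternionic pair `a, b` of `Q`-isometries (`a² = b² = −1`, `ab = −ba`); `bV` ANY basis of `V`
indexed by `Fin n`. A coefficient tensor `c : (Fin m → Fin n) → K` fixed by the Kronecker power `[z]_{bV}^{⊗m}` of every
`Q`-isometry `z` commuting with `a` and `b` is a `K`-combination of the tagged contractions
`taggedContraction (d ↦ [d]_{bV} [Q]_{bV}⁻¹) e δ` — perfect matchings `e` of the `m` positions, each pair contracted with the
Casimir matrix of one of `1, a, b, ab`. [cite: GoodmanWallachGTM255, §5.3.2 Thm. 5.3.3 (2), Thm. 5.3.5 and §4.2.2 Prop. 4.2.5] -/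
theorem mem_span_taggedContraction_of_centraliser_invariant [CharZero K] [Module.Finite K V]
    (hQs : ∀ x y, Q x y = Q y x) (hQn : Q.Nondegenerate)
    (haa : ∀ x, a (a x) = -x) (hbb : ∀ x, b (b x) = -x) (hab : ∀ x, a (b x) = -b (a x))
    (haQ : ∀ x y, Q (a x) (a y) = Q x y) (hQb : ∀ x y, Q (b x) (b y) = Q x y) (hi : i * i = -1)
    {n : ℕ} (bV : Basis (Fin n) K V) {m : ℕ} (c : (Fin m → Fin n) → K)
    (hc : ∀ z : V ≃ₗ[K] V, (∀ x, z (a x) = a (z x)) → (∀ x, z (b x) = b (z x)) → (∀ x y, Q (z x) (z y) = Q x y) →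
      tensorPowerMatrix K n m (LinearMap.toMatrix bV bV (z : V →ₗ[K] V)) *ᵥ c = c) :
    c ∈ Submodule.span K {f : (Fin m → Fin n) → K | ∃ (j : ℕ) (e : Fin m ≃ Fin 2 × Fin j) (δ : Fin j → Fin 4),
      f = taggedContraction (fun d : Fin 4 => LinearMap.toMatrix bV bV ((![(1 : V →ₗ[K] V), a, b, a * b] : Fin 4 → _) d) *
        (LinearMap.BilinForm.toMatrix bV Q)⁻¹) e δ} := by
  classical
  obtain ⟨k, β, hM, hb⟩ := exists_adaptedBasis (V := V) haa hbb hab hi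
  set P : Matrix (Fin k ⊕ Fin k) (Fin n) K := β.toMatrix bV with hPdef
  set P' : Matrix (Fin n) (Fin k ⊕ Fin k) K := bV.toMatrix β with hP'def
  have hP'P : P' * P = 1 := Basis.toMatrix_mul_toMatrix_flip bV β
  -- the tensor in the adapted basis
  set c' : (Fin m → Fin k ⊕ Fin k) → K := (Matrix.of fun (w' : Fin m → Fin k ⊕ Fin k) (w : Fin m → Fin n) =>
    ∏ t, P (w' t) (w t)) *ᵥ c with hc'def
  have hc' : ∀ z : V ≃ₗ[K] V, (∀ x, z (a x) = a (z x)) → (∀ x, z (b x) = b (z x)) → (∀ x y, Q (z x) (z y) = Q x y) →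
      (Matrix.of fun w' w : Fin m → Fin k ⊕ Fin k => ∏ t, LinearMap.toMatrix β β (z : V →ₗ[K] V) (w' t) (w t)) *ᵥ c' =
        c' := by
    intro z hza hzb hzQ
    have hzP : LinearMap.toMatrix β β (z : V →ₗ[K] V) * P = P * LinearMap.toMatrix bV bV (z : V →ₗ[K] V) := by
      rw [hPdef, linearMap_toMatrix_mul_basis_toMatrix, basis_toMatrix_mul_linearMap_toMatrix]
    have h := hc z hza hzb hzQ
    have htp : tensorPowerMatrix K n m (LinearMap.toMatrix bV bV (z : V →ₗ[K] V)) =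
        Matrix.of fun w' w : Fin m → Fin n => ∏ t, LinearMap.toMatrix bV bV (z : V →ₗ[K] V) (w' t) (w t) := rfl
    rw [htp] at h
    rw [hc'def, Matrix.mulVec_mulVec, ← of_prod_mul, hzP, of_prod_mul, ← Matrix.mulVec_mulVec, h]
  have hspan := mem_span_taggedContraction_adapted β hM hb hQs hQn haa hbb hab haQ hQb hi c' hc'
  -- back to `bV`
  have hcc' : c = (Matrix.of fun (w' : Fin m → Fin n) (w : Fin m → Fin k ⊕ Fin k) => ∏ t, P' (w' t) (w t)) *ᵥ c' := by
    rw [hc'def, Matrix.mulVec_mulVec, ← of_prod_mul, hP'P, of_prod_one, Matrix.one_mulVec]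
  have himg := Submodule.mem_map_of_mem
    (f := Matrix.mulVecLin (Matrix.of fun (w' : Fin m → Fin n) (w : Fin m → Fin k ⊕ Fin k) => ∏ t, P' (w' t) (w t))) hspan
  rw [Submodule.map_span] at himg
  rw [hcc', ← Matrix.mulVecLin_apply]
  refine Submodule.span_mono ?_ himg
  rintro _ ⟨f, ⟨j, e, δ, rfl⟩, rfl⟩
  refine ⟨j, e, δ, ?_⟩
  rw [Matrix.mulVecLin_apply]
  funext w'
  rw [Matrix.mulVec, dotProduct]
  have h := sum_prod_mul_taggedContraction P' (fun d : Fin 4 => LinearMap.toMatrix β β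
    ((![(1 : V →ₗ[K] V), a, b, a * b] : Fin 4 → _) d) * (LinearMap.BilinForm.toMatrix β Q)⁻¹) e δ w'
  simp only [Matrix.of_apply] at h ⊢
  rw [h]
  congr 1
  funext d
  exact casimir_basis_change β bV hQn _

/-- **The quaternionic tensor FFT from Cayley-commutator invariance**: the same conclusion if `c` is only assumed fixed by
`[ghg⁻¹h⁻¹]_{bV}^{⊗m}` for all `Q`-isometries `g, h` commuting with `a, b` and with `det(1 + g)`, `det(1 + h)` units (brick F1B:
transvections are such commutators, Lemma T, Zariski-closed stabilisers).
[cite: GoodmanWallachGTM255, §5.3.2 Thm. 5.3.3 (2) and §2.2.3 Exercise 1] [cite: Deligne1980, §4.4] -/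
theorem mem_span_taggedContraction_of_cayley_commutators [CharZero K] [Module.Finite K V]
    (hQs : ∀ x y, Q x y = Q y x) (hQn : Q.Nondegenerate)
    (haa : ∀ x, a (a x) = -x) (hbb : ∀ x, b (b x) = -x) (hab : ∀ x, a (b x) = -b (a x))
    (haQ : ∀ x y, Q (a x) (a y) = Q x y) (hQb : ∀ x y, Q (b x) (b y) = Q x y) (hi : i * i = -1)
    {n : ℕ} (bV : Basis (Fin n) K V) {m : ℕ} (c : (Fin m → Fin n) → K)
    (hc : ∀ g h : V ≃ₗ[K] V, (∀ x, g (a x) = a (g x)) → (∀ x, g (b x) = b (g x)) →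
      (∀ x y, Q (g x) (g y) = Q x y) → (∀ x, h (a x) = a (h x)) → (∀ x, h (b x) = b (h x)) →
      (∀ x y, Q (h x) (h y) = Q x y) →
      IsUnit (LinearMap.det ((g : V →ₗ[K] V) + 1)) → IsUnit (LinearMap.det ((h : V →ₗ[K] V) + 1)) →
      tensorPowerMatrix K n m (LinearMap.toMatrix bV bV ((g * h * g⁻¹ * h⁻¹ : V ≃ₗ[K] V) : V →ₗ[K] V)) *ᵥ c = c) :
    c ∈ Submodule.span K {f : (Fin m → Fin n) → K | ∃ (j : ℕ) (e : Fin m ≃ Fin 2 × Fin j) (δ : Fin j → Fin 4),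
      f = taggedContraction (fun d : Fin 4 => LinearMap.toMatrix bV bV ((![(1 : V →ₗ[K] V), a, b, a * b] : Fin 4 → _) d) *
        (LinearMap.BilinForm.toMatrix bV Q)⁻¹) e δ} :=
  mem_span_taggedContraction_of_centraliser_invariant hQs hQn haa hbb hab haQ hQb hi bV c fun _ hza hzb hzQ =>
    tensorPowerMatrix_mulVec_eq_of_cayley_commutators bV hQs hQn haa hbb hab haQ hQb hi c hc hza hzb hzQ

end AnyBasis

end Summit.HodgeConjecture.HodgeConjecture.Theorems.Q8SymplecticPowersQuaternionicTensorFFT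

end
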